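import Mathlib
import HarnessLib
import Summits.HubbardSuperconductivity.HubbardSuperconductivity.Theorems.KLProgrammeKLRegimeWickCumulantTree

/-!
# Route `KLProgramme` — ENGINE child (E2-v9): replica cumulants ARE the cumulants of the effective-action series
# (E2-WICK-ROADMAP §5 (i), bridge; cell gate-hubbard-kl, seat p1 g8)

The tree defines the next-scale action through the cumulant series `kernel (effAction C V) = −Σ_p (p!)⁻¹ kernel (κ_p)`,
`κ_p = cumulantOf (k ↦ e^{Δ_C}(X^k)) p`, `X = −V` (`GrassmannCumulantSeries.kernel_effAction_eq_neg_tsum`).  This file identifies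
those cumulants with the replica cumulants of the Wick files: for `x ∈ ⋀^{even}Γ` and `p ≥ 1`,

  `collapse_snd ( ursellOf (convMoment (allCov C) (a ↦ copy_a x)) univ ) = cumulantOf (k ↦ e^{Δ_C}(x^k)) p`      (`collapse_ursellOf_replica`),

and combines it with the tree formula `wickCumulant_treeOp` (p493450) into the form the Wick-ordered step consumes: with `x = e^{−Δ_{D+C}} w`
(the step's vertex, `w` the Wick action),

  `e^{Δ_D} κ_p = collapse_snd ( treeOp_{offCov C}(v, univ) ( e^{Δ_{offCov D}} ∏_a copy_a w ) )`      (`gaussConv_cumulantOf_eq_collapse_treeOp`):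

the soft smearing of the `p`-th cumulant of the step is the collapse of a BBF tree of inter-replica slice lines acting on the
inter-replica-soft-smeared product of `p` copies of the WICK action — no self-contractions.  Proved; no definitions; nothing about the
model is asserted.
-/

noncomputable section

namespace Summit.HubbardSuperconductivity.HubbardSuperconductivity.Theorems.KLRegimeWick

set_option linter.dupNamespace false -- summit = problem name (single-conjunct summit), D-0017

open Literature.MathematicalPhysics.QuantumLattice GrassmannAlgebra Finset Matrix
open Literature.Probability.LatticeModels

variable (R : Type*) [CommRing R] [Algebra ℚ R] {Γ : Type*} [Fintype Γ] [DecidableEq Γ] {n : ℕ}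

omit [Algebra ℚ R] in
/-- Collapsing a replica product of copies of `x` gives the power: `collapse_snd (∏_{a∈B} copy_a x) = x^{|B|}`. -/
theorem collapseEven_prod_replicaCopyEven (x : evenPart R Γ) (B : Finset (Fin n)) :
    collapseEven R (Prod.snd : Fin n × Γ → Γ) (∏ a ∈ B, replicaCopyEven R a x) = x ^ B.card := by
  rw [map_prod]
  refine (Finset.prod_congr rfl fun a _ => ?_).trans (Finset.prod_const x)
  exact Subtype.ext (by rw [coe_collapseEven, coe_replicaCopyEven, collapse_replicaCopy])

/-- Collapsing a replica moment of copies of `x` gives the power moment: `collapse_snd (𝓔_{allCov C}(∏_{a∈B} copy_a x)) = e^{Δ_C}(x^{|B|})`. -/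
theorem collapseEven_convMoment_replica (C : Matrix Γ Γ R) (x : evenPart R Γ) (B : Finset (Fin n)) :
    collapseEven R (Prod.snd : Fin n × Γ → Γ) (convMoment R (allCov R C) (fun a => replicaCopyEven R a x) B) =
      evenGaussConv R C (x ^ B.card) := by
  refine Subtype.ext ?_
  rw [coe_collapseEven, convMoment, coe_evenGaussConv, coe_evenGaussConv, ← gaussConv_collapse_snd, ← coe_collapseEven,
    collapseEven_prod_replicaCopyEven]

/-- **`collapse_ursellOf_replica` — replica cumulants are the power cumulants**: for `p ≥ 1`,
`collapse_snd (ursellOf (convMoment (allCov C) (a ↦ copy_a x)) univ) = cumulantOf (k ↦ e^{Δ_C}(x^k)) p`. -/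
theorem collapse_ursellOf_replica (C : Matrix Γ Γ R) (x : evenPart R Γ) (hn : 0 < n) :
    collapseEven R (Prod.snd : Fin n × Γ → Γ) (ursellOf (convMoment R (allCov R C) (fun a => replicaCopyEven R a x)) (univ : Finset (Fin n))) =
      cumulantOf (fun k => evenGaussConv R C (x ^ k)) n := by
  haveI : Nonempty (Fin n) := ⟨⟨0, hn⟩⟩
  have hμ0 : (fun k => evenGaussConv R C (x ^ k)) 0 = 1 :=
    Subtype.ext (by simp only [pow_zero, coe_evenGaussConv, OneMemClass.coe_one, gaussConv_one])
  rw [ursellOf_eq_sum_setPartitions _ (convMoment_empty R _ _) univ_nonempty, cumulantOf_eq_sum_setPartitions _ hμ0 hn, map_sum]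
  refine Finset.sum_congr rfl fun π _ => ?_
  rw [map_mul, map_mul, map_prod, map_pow, map_neg, map_one, map_natCast]
  congr 1
  exact Finset.prod_congr rfl fun B _ => collapseEven_convMoment_replica R C x B

/-- **`gaussConv_cumulantOf_eq_collapse_treeOp` — the step's cumulants in Wick form.**  For the Wick action `w ∈ ⋀^{even}`, slice `C`,
soft covariance `D`, `p ≥ 1` and any root `v`:
`e^{Δ_D} ( cumulantOf (k ↦ e^{Δ_C}((e^{−Δ_{D+C}} w)^k)) p ) = collapse_snd ( treeOp_{offCov C}(v, univ) ( e^{Δ_{offCov D}} ∏_a copy_a w ) )`. -/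
theorem gaussConv_cumulantOf_eq_collapse_treeOp (C D : Matrix Γ Γ R) (w : evenPart R Γ) (hn : 0 < n) (v : Fin n) :
    gaussConv R D ((cumulantOf (fun k => evenGaussConv R C
        ((⟨gaussConv R (-(D + C)) w, gaussConv_neg_mem_evenPart R _ w⟩ : evenPart R Γ) ^ k)) n : evenPart R Γ) : GrassmannAlgebra R Γ) =
      collapse R (Prod.snd : Fin n × Γ → Γ)
        (((treeOp R (offCov R (n := n) C) (Prod.fst : Fin n × Γ → Fin n) v univ : laplacianAlgebra R (offCov R (n := n) C) Prod.fst) :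
            Module.End R (GrassmannAlgebra R (Fin n × Γ)))
          (gaussConv R (offCov R D) ((∏ a, replicaCopyEven R a w : evenPart R (Fin n × Γ)) : GrassmannAlgebra R (Fin n × Γ)))) := by
  rw [← collapse_ursellOf_replica R C _ hn, coe_collapseEven, gaussConv_collapse_snd,
    wickCumulant_treeOp R C D (fun _ => w) univ (mem_univ v)]

end Summit.HubbardSuperconductivity.HubbardSuperconductivity.Theorems.KLRegimeWick

end
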